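/-
Copyright (c) 2026. All rights reserved.
Released under Apache 2.0 license as described in the file LICENSE.
Authors: abc-iut cell, seat abc-iut-L4-t10 (gen 5; row «JOINT», L4-lead m65/m73/m82: [AbsTopIII] Cor 3.6 (v) with the joint telecore
witness at the MLF model, and the joint witness at the archimedean models (finding F-L4t10g4-1) —
over abc-iut-w6-d025's route (β) spine and `Cor_3_6_joint`, consumed by name).
-/
import Literature.AnabelianGeometry.AbsoluteAnabelian.AbsTopIII.FrobeniusPictureMLFTelecoreJointModel
import Literature.AnabelianGeometry.AbsoluteAnabelian.AbsTopIII.FrobeniusPictureMLFLogTeleModel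
import Literature.AnabelianGeometry.AbsoluteAnabelian.AbsTopIII.FrobeniusPictureMLFShiftCompatibleModel
import Literature.AnabelianGeometry.AbsoluteAnabelian.AbsTopIII.FrobeniusPictureMLFModel
import Literature.AnabelianGeometry.AbsoluteAnabelian.AbsTopIII.AutHolLogFrobeniusCor45iiiCompatModelProofs
import HarnessLib

/-!
# [AbsTopIII] Cor 3.6 (v): EVERY printed sentence at the MLF model WITH the joint telecore witness;
# the joint witness at the archimedean models (PROOF-ONLY)

S. Mochizuki, *Topics in Absolute Anabelian Geometry III*, Cor. 3.6 (ii), (iii) second clause, (v) pp.79–80;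
Cor. 4.5 pp.107–109 (kurims manuscript, lit key `paper:url-5493eb38cbb7`; bib key `MochizukiAbsTopIII2015`).

Print constructs ONE telecore `𝔗_An` (resp. `𝔗_LH`) with ONE contact structure `ℋ_An` in (ii), and items
(iii) and (v) refer to THAT telecore; the cell's typed clauses `TelecoreStmt`, `LogObsCompatTelecoreStmt`,
`ShiftTelecoreCompatStmt` were discharged with two different telecores (seat abc-iut-L4-t10's finding
F-L4t10g4-1).  abc-iut-w6-d025's route (β) spine proves that the two telecores of record carry the SAME
family `𝒥` (`anTelecoreE_Jfam_eq`, p466410), the joint ∃-body over the abstract data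
(`joint_of_iotaOverGaloisStmt`, p467669), typed as `LogFrobeniusData.Cor_3_6_joint` with the MLF-model
instance `TFModel.cor_3_6_joint_model` (p468731).  This file (seat abc-iut-L4-t10, L4-lead m73/m82)
assembles, ON TOP of those declarations (consumed by name, nothing re-derived):

* ★ `AbsTopIII.TFModel.cor_3_6_v_all_model (hP) (I)` — **EVERY printed sentence of Cor 3.6 (v) at the MLF
  model `𝒳 = 𝒞^{MLF-sB}_{TF}` together with the joint witness**: (a) «`□` is a nexus» + (b) «`𝒟` is totally
  `□`-rigid» (`NexusRigidStmt`; binder `hP` = slimness on the class `P`, i.e. Prop 3.2 (iv) by name), (c) the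
  `ℤ`-action by nexus-classes of self-equivalences (`ShiftStmt`), (d) its compatibility with the cores and
  `𝔖_log` (`ShiftCompatStmt`) AND the telecore extension compatible with `𝒥` and `ℋ_An` for the SAME telecore as
  (ii), (iii) (`Cor_3_6_joint`) — binders EXACTLY {`hP`, `I`} (the L4-lead's COUNT-READ target, m82);
  `cor_3_6_v_all_isAffineModelAn` — the same at the slim affine sub-model `𝒳_{P₀^an}`, ZERO binders beyond `p`;
* `AbsTopIII.cor_3_6_joint_arch (𝔄)` / `_TM` — the joint witness at the archimedean models `𝒞^hol_TF`,
  `𝒞^hol_TM` of EVERY interface datum `𝔄` (Cor 4.5 (ii)/(iii)/(v)), ZERO binders (`id_⋎ = 𝟭`,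
  `arch_iotaOverGaloisStmt`, `arch_telecore_coherent`).

HONEST SCOPE: model-level ≠ node-level ≠ reconstruction; the MLF instance rests on the Cor-1.10 datum `I`
and (for (v) (a)(b)) slimness on `P`, exactly the binders of the cell's Cor 3.6 model column; nothing here
bears on [IUTchIII] Cor. 3.12 or takes a side; typed ≠ proved.  No definition, no instance, no named fact.
-/

namespace Literature.AnabelianGeometry.AbsoluteAnabelian

open _root_.CategoryTheory _root_.Quiver

universe u

/-! ### At the MLF model `𝒳 = 𝒞^{MLF-sB}_{TF}` — unconditional -/

namespace AbsTopIII

namespace TFModel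

open Literature.AlgebraicGeometry.Frobenioids (IsSlimGroup)

variable {p : ℕ} [Fact p.Prime] {P : ObjectProperty (TFModel p)} {D : Type 1} [Category.{1} D]

/-- ★ **[AbsTopIII] Cor 3.6 (v), EVERY printed sentence, AT THE MLF MODEL, with the joint telecore
witness**: (a) «`□` is a nexus» + (b) «`𝒟` is totally `□`-rigid» (`NexusRigidStmt`, abc-iut-L4-t5's
`nexusRigidStmt_model` — Prop 3.2 (iv) from slimness on the class `P`, binder `hP`); (c) «the `ℤ`-action on
`Γ⃗_{𝒟≤1}` extends to `𝒟` by nexus-classes of self-equivalences» (`ShiftStmt`, zero binders); (d) «compatible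
with the cores and observable of (i), (iii)» (`ShiftCompatStmt`, abc-iut-w6-d023's `shiftCompatStmt_model`)
and «extend to the telecore of (ii) compatibly with its family AND `ℋ_An`» — the latter WITH THE SAME
telecore as (ii) and (iii) (`Cor_3_6_joint`).  Binders ⊆ {`hP` (slimness on `P`), `I` (Cor-1.10 datum)}.
[cite: MochizukiAbsTopIII2015, Corollary 3.6 (v) p.80] -/
theorem cor_3_6_v_all_model (hP : ∀ A : TFModel p, P A → IsSlimGroup A.pair.Pi)
    (I : AnabelianInput p P D) :
    (monoAnabelianData I).toLogFrobeniusData.NexusRigidStmt ∧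
      (monoAnabelianData I).toLogFrobeniusData.ShiftStmt ∧
      (monoAnabelianData I).toLogFrobeniusData.ShiftCompatStmt ∧
      (monoAnabelianData I).toLogFrobeniusData.Cor_3_6_joint (monoAnabelianData I).telecoreData :=
  ⟨nexusRigidStmt_model hP I, (monoAnabelianData I).toLogFrobeniusData.shiftStmt, shiftCompatStmt_model I,
    cor_3_6_joint_model I⟩

/-- ★ **Every printed sentence of Cor 3.6 (v) with the joint telecore witness at the SLIM affine sub-model
`𝒳_{P₀^an}` — ZERO binders beyond `p`**: the two binders {`hP`, `I`} of `cor_3_6_v_all_model` are jointly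
inhabited at a genuine non-vacuous sub-model (slimness: abc-iut's `isSlimGroup_of_isAffineModelAn`; Cor-1.10
datum `AnabelianInput.ofFull` over the full Galois functor `full_galP_isAffineModelAn`), cf. abc-iut-w6-d025's
`cor_3_6_joint_isAffineModelAn`. [cite: MochizukiAbsTopIII2015, Corollary 3.6 (v) p.80] -/
theorem cor_3_6_v_all_isAffineModelAn :
    (monoAnabelianData (AnabelianInput.ofFull p (IsAffineModelAn (p := p))
        full_galP_isAffineModelAn)).toLogFrobeniusData.NexusRigidStmt ∧
      (monoAnabelianData (AnabelianInput.ofFull p (IsAffineModelAn (p := p))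
        full_galP_isAffineModelAn)).toLogFrobeniusData.ShiftStmt ∧
      (monoAnabelianData (AnabelianInput.ofFull p (IsAffineModelAn (p := p))
        full_galP_isAffineModelAn)).toLogFrobeniusData.ShiftCompatStmt ∧
      (monoAnabelianData (AnabelianInput.ofFull p (IsAffineModelAn (p := p))
        full_galP_isAffineModelAn)).toLogFrobeniusData.Cor_3_6_joint
        (monoAnabelianData (AnabelianInput.ofFull p (IsAffineModelAn (p := p))
          full_galP_isAffineModelAn)).telecoreData :=
  cor_3_6_v_all_model (fun _ hA => isSlimGroup_of_isAffineModelAn hA) _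

end TFModel

/-! ### The joint witness at the archimedean models -/

variable (𝔄 : AutHolFieldFunctor.{u})

/-- **`Cor_3_6_joint` at the archimedean model `𝒳 = 𝒞^hol_TF` of EVERY interface datum `𝔄` — ZERO binders**
(`id_⋎ = 𝟭` fully faithful, `arch_iotaOverGaloisStmt`, `arch_telecore_coherent`).
[cite: MochizukiAbsTopIII2015, Corollary 4.5 (ii)/(iii)/(v) pp.107–109] -/
theorem cor_3_6_joint_arch :
    (archLogFrobeniusData 𝔄).Cor_3_6_joint (archTelecoreData 𝔄) :=
  (archLogFrobeniusData 𝔄).cor_3_6_joint_of_iotaOverGaloisStmt (archTelecoreData 𝔄)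
    (Functor.FullyFaithful.id _) (arch_iotaOverGaloisStmt 𝔄) (arch_telecore_coherent 𝔄)

/-- **`Cor_3_6_joint` at the archimedean model `𝒳 = 𝒞^hol_TM` of every `𝔄` — ZERO binders**
(`archTM_iotaOverGaloisStmt`, abc-iut-w5-d226's `archTM_telecore_coherent`).
[cite: MochizukiAbsTopIII2015, Corollary 4.5 (ii)/(iii)/(v) pp.107–109] -/
theorem cor_3_6_joint_arch_TM :
    (archLogFrobeniusDataTM 𝔄).Cor_3_6_joint (archTelecoreDataTM 𝔄) :=
  (archLogFrobeniusDataTM 𝔄).cor_3_6_joint_of_iotaOverGaloisStmt (archTelecoreDataTM 𝔄)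
    (Functor.FullyFaithful.id _) (archTM_iotaOverGaloisStmt 𝔄) (archTM_telecore_coherent 𝔄)

end AbsTopIII

end Literature.AnabelianGeometry.AbsoluteAnabelian
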